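/-
COR-CM (cell pub-hodgecm2, stage 2 of the Hodge ladder) — TRANSPOSITION surge (COORDINATOR RULING — HODGE RE-POINT
2026-08-21T12:07:17Z (2)(3); hodge-director/TRANSPOSITION-MAP.md §0-v5): the DISCHARGE FILE for DICTIONARY ITEM (v) of rfwf v3 §4.2
(tex ll.253–258), seat prover-pub-hodgecm2-tr-prover-5-0 (unit pub-hodgecm2-tr-prover-5), 2026-08-21; path named under the lead's
rule (1) pattern `Transposition/Item5*Holds.lean` (HOME/INBOX l.3752 (3), l.3766–3768, l.3780).  Co-credit: prover-pub-hodgecm2-b09-g14-0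
(acting tr-prover-5 until 13:20Z) prepared the same port chain independently (P1 of record p274312; staged bridge
`HOME/pub-hodgecm2-b09/Item5IsolationSpansHolds.lean` c23c5b70e3dc, whose `gen12_of_generators` and `wedgePairingExists_ofSetting` are
taken over here by name; HOME/INBOX l.3798).
TAG OF THE ITEM: VERBATIM (typer, `Item5IsolationSpans.lean` header).  What «VERBATIM» means in bytes: the stage-1 proof of PerL
Prop 3.6 ∕ Thm 3.7 is an ABSTRACT Hilbert-space theorem (PKG `HodgeCM/Prior/Perl34.lean` :531 ∕ :676 ∕ :685 — no field, degree,
frame or sign-table binder), now PORTED to the tree as `CorCM/Prior/Perl34IsolationSetting.lean` + `Perl34IsolationTheorems.lean`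
(same seat); this file instantiates item (v)'s typed interface (`Transposition.IsolationSpans.SpansCoincide`, `.Real34`,
`IsolationSpans`) at the datum of ANY isolation setting — i.e. at a face exactly as at PerL's sextic configuration.
FRAMING (COORDINATOR RULING 2026-08-21T11:55:35Z): `HC_CM` is NOT proved.  Nothing here constructs an isolation setting, theta
one-forms or `L²`-embeddings for any face; those are items (ii)∕(iii)∕(iv)∕(vi) and the model-side B01 construction.
-/
import Summits.HodgeConjecture.CorCM.B01.Transposition.Item5IsolationSpans
import Summits.HodgeConjecture.CorCM.Prior.Perl34IsolationTheorems
import HarnessLib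

/-!
# Transposition item (v) — DISCHARGED at the abstract layer: Thm 3.7 (`SpansCoincide`) holds for the datum of every isolation setting

Item (v) of rfwf v3 §4.2 (tex ll.253–258: PerL Lemma 3.4 seesaw, Lemma 3.5 `S₁₂` = closed span of wedges, Prop 3.6 isolation,
Thm 3.7 the two spans coincide — «general — the four types enter only through the archimedean characters w, w′»).

The typed interface (`Item5IsolationSpans.lean`, p272477) splits item (v) into three separately dischargeable targets over a datum
`D = (S₁₂, S₃₄)` — `Gen12` (L3.4+L3.5, seesaw direction), `SpansCoincide` (P3.6+T3.7), `Real34` (L3.5, generation direction) —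
with the proved composition `IsolationSpans.of_gen12_spansCoincide_real34`.  Here:

* `IsolationSpans.Datum.ofSetting S` — THE datum PerL means: `S₁₂ := S.t12.S12`, `S₃₄ := S.t34.S12`, the closed spans of the
  theta functions `ϑ_{T,χ}(Φ)` of the two torus sides of an isolation setting `S : Perl34.IsolationSetting …` (PKG
  `ThetaRealisation.S`, `Automorphic/Realisation.lean`:122; tree port `Perl34IsolationSetting.lean`).
* `IsolationSpans.spansCoincide_ofSetting S : SpansCoincide (Datum.ofSetting S)` — **PerL Thm 3.7 DISCHARGED** for every such
  datum, BY NAME from the ported stage-1 theorem `Perl34.IsolationSetting.C2_S12_eq_S34` (its hypotheses `H_chars12/34` = PerL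
  Lemma 4.2(b) and `H_occ12/34` = Lemma 4.1(c) are FIELDS of `IsolationSetting`, PKG :309–321, i.e. inputs of item (vi) in rfwf's
  dictionary); `spans_eq_Sfull_ofSetting` is the full statement `S₁₂ = S₃₄ = closure Σ_Φ 𝒯_Φ(L²([U(W)]))` (`C2_thm37`), and
  `prop36_ofSetting₁₂/₃₄` surface Prop 3.6 (`C1_prop36`) on both sides.
* `IsolationSpans.real34_ofSetting_iff` — the tree's CLOSURE form `Real34` (a bound on the span `S₃₄`) is EQUIVALENT, for the datum
  of a setting, to the stage-1 GENERATOR form (PKG field `ThetaRealisation.real34` :143–145 ∕ `ThetaModel.Open_thetaReal34`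
  `ThetaFacts.lean`:213–217: each generator `ϑ_{T′,χ}(Φ)`, `χ` allowed, lies in the closed span of the theta (34)-wedge-functions) —
  the equivalence the typer's docstring asserts (`TorusData.S12_def` + `Submodule.topologicalClosure_minimal`), now proved.
* `IsolationSpans.ofSetting` — item (v)'s interface of record `IsolationSpans U emb Θ` from an isolation setting plus the two
  Lemma-3.5 inputs in their STAGE-1 shapes (`Gen12` into `S.t12.S12`; generator-form `real34`): literally PKG
  `StubTree.thm44_of_realisation` Steps 1–3 (`StubTree/PerLProof.lean`:146–158) with `R.S`, `R.gen12`, `R.real34`, `R.S.C2_S12_eq_S34`.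
* `periodNV_ofSetting` — the whole of PKG `thm44_of_realisation` in tree vocabulary: isolation setting + gen12 + real34 + line
  field + item (iii)'s bookkeeping ⇒ `U.PeriodNV ι₁ V K Ψ σ` (via the typer's `IsolationSpans.periodNV`), and
  `faceThetaDatum_ofSetting` — the same data packaged as the socket datum `Universe.FaceThetaDatum` (`B01/ThetaRealisationSocket.lean`:66)
  that `Universe.FaceThetaDataExists` (`Transposition/Assembly.lean`:52) asks for, so that a stage-1-shaped `ThetaRealisation` at a
  face context feeds the day-1 assembly with no further glue.

What remains OPEN for item (v) at a face, said plainly: an INSTANCE — the isolation setting of the seesaw plane `W ⊂ V` of item (iv)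
with the archimedean weights `w, w′` read off `f.psi`, its fields `H_chars`∕`H_occ` (item (vi): Lemma 4.2(b) ∕ 4.1(c)), and the
two Lemma-3.5 memberships `Gen12`∕`real34` for the theta one-forms the model supplies (PKG `ThetaModel.Open_thetaGen12/Real34`,
discharged in stage 1 inside the E term of record for the sextic configuration only).  No statement in this file depends on the
degree of the CM field, on a frame, or on a sign table.
-/

noncomputable section

open scoped TensorProduct InnerProductSpace

namespace Summit.HodgeConjecture.CorCM

open Literature.AlgebraicGeometry.Motives (CMType HodgeStructure)
open Literature.AlgebraicGeometry.Motives.HodgeStructure (conj)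
open Prior.Perl34File (Perl34.IsolationSetting)
open Prior.Perl34File.Perl34

namespace Transposition

namespace IsolationSpans

variable {U : Universe} {L : CMField} {ι₁ : L →+* ℂ} {V : HermSpace3 L ι₁}
  {H HG CG G SK SigIdx SigIdxG : Type*}
  [NormedAddCommGroup H] [InnerProductSpace ℂ H] [CompleteSpace H]
  [NormedAddCommGroup HG] [InnerProductSpace ℂ HG] [CompleteSpace HG]
  [NormedAddCommGroup CG] [NormedSpace ℂ CG]
  [Group G] [TopologicalSpace G] [TopologicalSpace SK]
  {emb : ∀ Γ : Level V, U.CohC (U.pms L ι₁ V Γ) 2 →ₗ[ℂ] HG}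
  {Θ : Fin 4 → ∀ Γ : Level V, Set (U.CohC (U.pms L ι₁ V Γ) 1)}

/-! ## §1  The datum of an isolation setting; Thm 3.7 and Prop 3.6 for it -/

/-- **The datum PerL means** (PerL §3.3, tex ll.348–349; PKG `ThetaRealisation.S` `Automorphic/Realisation.lean`:122 with
`gen12 : … ∈ S.t12.S12` :136–137): for an isolation setting `S` (core `L²([U(W)]) → L²([G_U])` + the two torus sides
`(T, w)`, `(T′, w′)` with their hypotheses `H_chars`, `H_occ`), `S₁₂ := S.t12.S12` and `S₃₄ := S.t34.S12` — the closed spans of the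
theta functions `ϑ_{T,χ}(Φ)`, resp. `ϑ_{T′,χ}(Φ)` (`TorusData.S12_def`). [folklore] -/
def Datum.ofSetting (S : Perl34.IsolationSetting H HG CG G SK SigIdx SigIdxG) : IsolationSpans.Datum HG :=
  ⟨S.t12.S12, S.t34.S12⟩

/-- `(Datum.ofSetting S).S12 = S.t12.S12` by construction. [folklore] -/
@[simp] theorem Datum.ofSetting_S12 (S : Perl34.IsolationSetting H HG CG G SK SigIdx SigIdxG) :
    (Datum.ofSetting S).S12 = S.t12.S12 := rfl

/-- `(Datum.ofSetting S).S34 = S.t34.S12` by construction (the (34) side is a second `TorusData` over the same core, whose own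
span field is again called `S12`; PKG `IsolationSetting.t34` :304). [folklore] -/
@[simp] theorem Datum.ofSetting_S34 (S : Perl34.IsolationSetting H HG CG G SK SigIdx SigIdxG) :
    (Datum.ofSetting S).S34 = S.t34.S12 := rfl

/-- **Item (v), target `SpansCoincide` — DISCHARGED for the datum of every isolation setting (PerL Thm 3.7 `thm:R`, tex ll.440–458):**
`S₁₂ = S₃₄`, by name from the ported stage-1 theorem `Perl34.IsolationSetting.C2_S12_eq_S34` (PKG `Prior/Perl34.lean`:685; tree
`CorCM/Prior/Perl34IsolationTheorems.lean`).  Field-, degree-, frame- and sign-free: a face owes only the instance `S`. [folklore] -/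
theorem spansCoincide_ofSetting (S : Perl34.IsolationSetting H HG CG G SK SigIdx SigIdxG) :
    SpansCoincide (Datum.ofSetting S) :=
  S.C2_S12_eq_S34

/-- **PerL Thm 3.7 in full** (tex l.444): `S₁₂ = S₃₄ = closure(Σ_{Φ ∈ 𝒮^κ} 𝒯_Φ(L²([U(W)])))` (`IsolationSetting.Sfull`), by name from
the ported `Perl34.IsolationSetting.C2_thm37` (PKG :676). [folklore] -/
theorem spans_eq_Sfull_ofSetting (S : Perl34.IsolationSetting H HG CG G SK SigIdx SigIdxG) :
    (Datum.ofSetting S).S12 = S.Sfull ∧ (Datum.ofSetting S).S34 = S.Sfull :=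
  S.C2_thm37

/-- **PerL Prop 3.6** `prop:isol` (tex ll.397–439), (12) side, surfaced on the datum: for every `Φ ∈ 𝒮^κ`, `𝒯_Φ(L²_w) ⊆ S₁₂` — by name
from the ported `Perl34.TorusData.C1_prop36` (PKG :531) under the setting's own `H_chars12`. [folklore] -/
theorem prop36_ofSetting₁₂ (S : Perl34.IsolationSetting H HG CG G SK SigIdx SigIdxG) (Φ : SK) :
    ∀ v ∈ S.t12.L2w, S.core.TΦ Φ v ∈ (Datum.ofSetting S).S12 :=
  S.t12.C1_prop36 S.H_chars12 Φ

/-- **PerL Prop 3.6**, (34) side: for every `Φ ∈ 𝒮^κ`, `𝒯_Φ(L²_{w′}) ⊆ S₃₄` (`C1_prop36` under `H_chars34`). [folklore] -/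
theorem prop36_ofSetting₃₄ (S : Perl34.IsolationSetting H HG CG G SK SigIdx SigIdxG) (Φ : SK) :
    ∀ v ∈ S.t34.L2w, S.core.TΦ Φ v ∈ (Datum.ofSetting S).S34 :=
  S.t34.C1_prop36 S.H_chars34 Φ

/-! ## §2  Lemma 3.5, generation direction: the tree's closure form `Real34` ⇔ the stage-1 generator form -/

/-- **Generator form ⇒ closure form.**  If every generator `ϑ_{T′,χ}(Φ)` of `S₃₄` (`χ` allowed of type (34), `Φ ∈ 𝒮^κ`) lies in the
closed span of the theta (34)-wedge-functions — the STAGE-1 shape of Lemma 3.5's generation direction (PKG field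
`ThetaRealisation.real34`, `Automorphic/Realisation.lean`:143–145; `ThetaModel.Open_thetaReal34`, `ThetaFacts.lean`:213–217) — then the
whole closed span `S₃₄` does (`TorusData.S12_def` + `Submodule.topologicalClosure_minimal`): the tree's `Real34` for the datum of the
setting. [folklore] -/
theorem real34_ofSetting (S : Perl34.IsolationSetting H HG CG G SK SigIdx SigIdxG)
    (hr : ∀ χ : S.t34.X, S.t34.allowed χ → ∀ Φ : SK,
      S.t34.ϑ χ Φ ∈ (Submodule.span ℂ (thetaWedgeFns U emb Θ 2 3)).topologicalClosure) :
    Real34 U emb Θ (Datum.ofSetting S) := by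
  show S.t34.S12 ≤ _
  rw [S.t34.S12_def]
  refine Submodule.topologicalClosure_minimal _ (Submodule.span_le.mpr ?_) (Submodule.isClosed_topologicalClosure _)
  rintro _ ⟨χ, hχ, Φ, rfl⟩
  exact hr χ hχ Φ

/-- **Closure form ⇒ generator form**: each generator `ϑ_{T′,χ}(Φ)` lies in `S₃₄` (`Submodule.subset_span`, `le_topologicalClosure`),
hence in any closed subspace containing `S₃₄`.  (The allowedness hypothesis is idle here — every `χ : S.t34.X` is allowed by the
setting's `H_chars34` — and is kept only to match the stage-1 signature.) [folklore] -/
theorem generators_of_real34_ofSetting (S : Perl34.IsolationSetting H HG CG G SK SigIdx SigIdxG)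
    (h : Real34 U emb Θ (Datum.ofSetting S)) :
    ∀ χ : S.t34.X, S.t34.allowed χ → ∀ Φ : SK,
      S.t34.ϑ χ Φ ∈ (Submodule.span ℂ (thetaWedgeFns U emb Θ 2 3)).topologicalClosure := by
  intro χ hχ Φ
  refine h ?_
  show S.t34.ϑ χ Φ ∈ S.t34.S12
  rw [S.t34.S12_def]
  exact Submodule.le_topologicalClosure _ (Submodule.subset_span ⟨χ, hχ, Φ, rfl⟩)

/-- **`Real34` ⇔ the stage-1 generator form**, for the datum of an isolation setting — the equivalence asserted in the docstring of
`Transposition.IsolationSpans.Real34` (`Item5IsolationSpans.lean`), now a theorem. [folklore] -/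
theorem real34_ofSetting_iff (S : Perl34.IsolationSetting H HG CG G SK SigIdx SigIdxG) :
    Real34 U emb Θ (Datum.ofSetting S) ↔
      ∀ χ : S.t34.X, S.t34.allowed χ → ∀ Φ : SK,
        S.t34.ϑ χ Φ ∈ (Submodule.span ℂ (thetaWedgeFns U emb Θ 2 3)).topologicalClosure :=
  ⟨generators_of_real34_ofSetting S, real34_ofSetting S⟩

/-- **Lemma 3.4 + 3.5, seesaw direction, GENERATOR form ⇒ `Gen12`** (b09): if every theta (12)-wedge-function IS a theta function
`ϑ_{T,χ}(Φ)` of the (12) side for an allowed `χ` — PerL Lemma 3.4, the seesaw identity `θ_{φ₁}(χ′₁) θ_{φ₂}(χ′₂) = ϑ_{T,χ′₁⊠χ′₂}(Φ₁ ⊗ Φ₂)`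
(tex ll.350–396; Kudla's splitting [HKS, GI]) — then it lies in `S₁₂` (a generator lies in the closed span, `TorusData.S12_def`). [folklore] -/
theorem gen12_ofSetting (S : Perl34.IsolationSetting H HG CG G SK SigIdx SigIdxG)
    (hgen : ∀ (Γ : Level V) (ω₁ ω₂ : U.CohC (U.pms L ι₁ V Γ) 1), ω₁ ∈ Θ 0 Γ → ω₂ ∈ Θ 1 Γ →
      ∃ χ : S.t12.X, S.t12.allowed χ ∧ ∃ Φ : SK, emb Γ (U.cup2C (U.pms L ι₁ V Γ) 1 ω₁ ω₂) = S.t12.ϑ χ Φ) :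
    Gen12 U emb Θ (Datum.ofSetting S) := by
  intro Γ ω₁ ω₂ h₁ h₂
  obtain ⟨χ, hχ, Φ, he⟩ := hgen Γ ω₁ ω₂ h₁ h₂
  show emb Γ (U.cup2C (U.pms L ι₁ V Γ) 1 ω₁ ω₂) ∈ S.t12.S12
  rw [S.t12.S12_def, he]
  exact Submodule.le_topologicalClosure _ (Submodule.subset_span ⟨χ, hχ, Φ, rfl⟩)

/-! ## §3  Item (v)'s interface of record from an isolation setting (= PKG `thm44_of_realisation` Steps 1–3) -/

/-- **`IsolationSpans` from an isolation setting** — PKG `StubTree.thm44_of_realisation` Steps 1–3 (`StubTree/PerLProof.lean`:146–158)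
in tree vocabulary: Lemma 3.5 (seesaw direction) puts every theta (12)-wedge-function in `S₁₂ = S.t12.S12` (`hg`, the shape of PKG
`ThetaRealisation.gen12` :136–137); Thm 3.7 (`spansCoincide_ofSetting`, PROVED) moves it to `S₃₄`; Lemma 3.5 (generation direction,
generator form `hr` = PKG `ThetaRealisation.real34` :143–145) bounds `S₃₄` by the closed span of the theta (34)-wedge-functions
(`real34_ofSetting`).  So at the face context item (v) is REDUCED to the instance `S` and the two Lemma-3.5 memberships, exactly the
stage-1 shape; no degree, frame or sign hypothesis. [folklore] -/
theorem ofSetting (S : Perl34.IsolationSetting H HG CG G SK SigIdx SigIdxG)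
    (hg : Gen12 U emb Θ (Datum.ofSetting S))
    (hr : ∀ χ : S.t34.X, S.t34.allowed χ → ∀ Φ : SK,
      S.t34.ϑ χ Φ ∈ (Submodule.span ℂ (thetaWedgeFns U emb Θ 2 3)).topologicalClosure) :
    IsolationSpans U emb Θ :=
  of_gen12_spansCoincide_real34 hg (spansCoincide_ofSetting S) (real34_ofSetting S hr)

/-- The same with `Gen12` written out against `S.t12.S12` (the literal type of PKG `ThetaRealisation.gen12`, with the wedge-function
`Λ Γ ω₁ ω₂` spelled `emb Γ (ω₁ ∪ ω₂)` as in the tree socket). [folklore] -/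
theorem ofSetting' (S : Perl34.IsolationSetting H HG CG G SK SigIdx SigIdxG)
    (hg : ∀ (Γ : Level V) (ω₁ ω₂ : U.CohC (U.pms L ι₁ V Γ) 1), ω₁ ∈ Θ 0 Γ → ω₂ ∈ Θ 1 Γ →
      emb Γ (U.cup2C (U.pms L ι₁ V Γ) 1 ω₁ ω₂) ∈ S.t12.S12)
    (hr : ∀ χ : S.t34.X, S.t34.allowed χ → ∀ Φ : SK,
      S.t34.ϑ χ Φ ∈ (Submodule.span ℂ (thetaWedgeFns U emb Θ 2 3)).topologicalClosure) :
    IsolationSpans U emb Θ :=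
  ofSetting S hg hr

/-- **Down to the ∃-form the engine consumes** (b09): isolation setting + the two Lemma-3.5 memberships + item (vi)'s line field (PerL
Prop 4.3) ⇒ `WedgePairingExists U emb Θ`, by the typer's `wedgePairingExists_of_lineField`. [folklore] -/
theorem wedgePairingExists_ofSetting (S : Perl34.IsolationSetting H HG CG G SK SigIdx SigIdxG)
    (hg : Gen12 U emb Θ (Datum.ofSetting S))
    (hr : ∀ χ : S.t34.X, S.t34.allowed χ → ∀ Φ : SK,
      S.t34.ϑ χ Φ ∈ (Submodule.span ℂ (thetaWedgeFns U emb Θ 2 3)).topologicalClosure)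
    (lineField : ∃ (Γ : Level V), ∃ ω₁ ∈ Θ 0 Γ, ∃ ω₂ ∈ Θ 1 Γ, emb Γ (U.cup2C (U.pms L ι₁ V Γ) 1 ω₁ ω₂) ≠ 0) :
    WedgePairingExists U emb Θ :=
  wedgePairingExists_of_lineField lineField (ofSetting S hg hr)

/-! ## §4  The engine and the socket datum from stage-1-shaped realisation data -/

/-- **PKG `thm44_of_realisation` in tree vocabulary** (`StubTree/PerLProof.lean`:142–188): an isolation setting, the two Lemma-3.5
memberships, item (vi)'s line field (PerL Prop 4.3), items (ii)∕(vi)'s typing `Θ i Γ ⊆ U_{Ψ i}(Γ)` and item (iii)'s bookkeeping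
(`cover`, `emb_cover`, Petersson = period `inner_emb`) give `U.PeriodNV ι₁ V K Ψ σ` — Steps 1–3 by `ofSetting`, Steps 4–6 by the
typer's `IsolationSpans.periodNV` (`Item5IsolationSpans.lean`).  Universe facts used: `Fact_pull_comp`, `Fact_pull_hodge`,
`Fact_cup2_hodge`, `Fact_pull_cup` (as the tree engine `periodNV_of_faceThetaDatum`, `ThetaRealisationSocket.lean`:106). [folklore] -/
theorem periodNV_ofSetting (hc : U.Fact_pull_comp) (hH : U.Fact_pull_hodge) (hcup2 : U.Fact_cup2_hodge)
    (hpc : U.Fact_pull_cup) {K : CMField} {Ψ : Fin 4 → CMType K} {σ : K →+* ℂ}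
    (S : Perl34.IsolationSetting H HG CG G SK SigIdx SigIdxG)
    (Theta_sub : ∀ (i : Fin 4) (Γ : Level V), Θ i Γ ⊆ U.Uiso Γ K (Ψ i) σ)
    (lineField : ∃ (Γ : Level V), ∃ ω₁ ∈ Θ 0 Γ, ∃ ω₂ ∈ Θ 1 Γ, emb Γ (U.cup2C (U.pms L ι₁ V Γ) 1 ω₁ ω₂) ≠ 0)
    (hg : Gen12 U emb Θ (Datum.ofSetting S))
    (hr : ∀ χ : S.t34.X, S.t34.allowed χ → ∀ Φ : SK,
      S.t34.ϑ χ Φ ∈ (Submodule.span ℂ (thetaWedgeFns U emb Θ 2 3)).topologicalClosure)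
    (cover : ∀ (Γ Γ' : Level V), Γ' ≤ Γ → U.Mor (U.pms L ι₁ V Γ') (U.pms L ι₁ V Γ))
    (emb_cover : ∀ (Γ Γ' : Level V) (hle : Γ' ≤ Γ) (x : U.CohC (U.pms L ι₁ V Γ) 2),
      emb Γ' (U.pullC (cover Γ Γ' hle) 2 x) = emb Γ x)
    (inner_emb : ∀ Γ : Level V, ∃ c : ℂ, c ≠ 0 ∧ ∀ x y : U.CohC (U.pms L ι₁ V Γ) 2,
      x ∈ (U.hodge (U.pms L ι₁ V Γ) 2).F 2 → y ∈ (U.hodge (U.pms L ι₁ V Γ) 2).F 2 →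
        ⟪emb Γ y, emb Γ x⟫_ℂ = c * U.trC (U.pms L ι₁ V Γ) 4 (U.cup2C (U.pms L ι₁ V Γ) 2 x (conj y))) :
    U.PeriodNV ι₁ V K Ψ σ :=
  IsolationSpans.periodNV hc hH hcup2 hpc Theta_sub lineField (ofSetting S hg hr) cover emb_cover inner_emb

/-! ## §5  The MEETING form — what the E term of record actually instantiates (PKG `Model/EndStateMeet.lean`)

Stage 1's E term of record («UARM»∕«JBUARM») inhabits the pointwise record `ThetaModel.AllCharsNonDesignPt₂ S` whose theta
inputs are the MEETING forms C5′ `gen12Meet` (a non-zero theta (12)-wedge-function is not orthogonal to `S₁₂`) and C6′ `real34Meet`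
(a (12)-wedge-function of `U_Ψ`-classes pairing non-trivially with a generator `ϑ_{T′,χ}(Φ)` pairs non-trivially, at ONE level, with a
(34)-wedge-function of `U_Ψ`-classes) — PKG `Universe.ThetaRealisation₂` (`Model/EndStateMeet.lean`:124–152) and
`ModelAxiomsPerL.thm44_of_realisation₂` (:200–222), which STILL consumes Thm 3.7 (`R.S.C2_S12_eq_S34`).  The two theorems below are
their tree twins, so that a face head transposed BY NAME from the record lands on `U.PeriodNV` with no further glue; the meeting forms do
not give the socket's closure-form `coupling`, and need not: `PeriodNV` per face is what `hc_cm_closed_of_exists_facePeriod`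
(`CorCM/FacePeriodWitnesses.lean`:189) consumes. -/

omit [CompleteSpace HG] in
/-- **Steps 5–6 of PerL Thm 4.4 at one level** (PKG `thm44_of_realisation₂` Steps 5–6; tree `periodNV_of_faceThetaDatum` Steps 4–5,
`ThetaRealisationSocket.lean`): four `U_Ψ`-classes at one level whose (34)- and (12)-wedge-functions have non-zero Petersson pairing
give `U.PeriodNV ι₁ V K Ψ σ` — Petersson = period on `(2,0)`-wedges (`inner_emb`, `cup2C_mem_F_two_of_Uiso`, `period_eq_pairing_wedges`),
then multilinear expansion to pure pull-backs (`periodNV_of_period_ne_zero`). [folklore] -/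
theorem periodNV_of_inner_wedgeFns_ne_zero (hH : U.Fact_pull_hodge) (hcup2 : U.Fact_cup2_hodge)
    {K : CMField} {Ψ : Fin 4 → CMType K} {σ : K →+* ℂ}
    (inner_emb : ∀ Γ : Level V, ∃ c : ℂ, c ≠ 0 ∧ ∀ x y : U.CohC (U.pms L ι₁ V Γ) 2,
      x ∈ (U.hodge (U.pms L ι₁ V Γ) 2).F 2 → y ∈ (U.hodge (U.pms L ι₁ V Γ) 2).F 2 →
        ⟪emb Γ y, emb Γ x⟫_ℂ = c * U.trC (U.pms L ι₁ V Γ) 4 (U.cup2C (U.pms L ι₁ V Γ) 2 x (conj y)))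
    (Γ : Level V) (ω : Fin 4 → U.CohC (U.pms L ι₁ V Γ) 1) (hU : ∀ i, ω i ∈ U.Uiso Γ K (Ψ i) σ)
    (hne : ⟪emb Γ (U.cup2C (U.pms L ι₁ V Γ) 1 (ω 2) (ω 3)), emb Γ (U.cup2C (U.pms L ι₁ V Γ) 1 (ω 0) (ω 1))⟫_ℂ ≠ 0) :
    U.PeriodNV ι₁ V K Ψ σ := by
  obtain ⟨c, -, hcΛ⟩ := inner_emb Γ
  have hx : U.cup2C (U.pms L ι₁ V Γ) 1 (ω 0) (ω 1) ∈ (U.hodge (U.pms L ι₁ V Γ) (1 + 1)).F (1 + 1) :=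
    Universe.cup2C_mem_F_two_of_Uiso hH hcup2 Γ K (Ψ 0) (Ψ 1) σ (hU 0) (hU 1)
  have hy : U.cup2C (U.pms L ι₁ V Γ) 1 (ω 2) (ω 3) ∈ (U.hodge (U.pms L ι₁ V Γ) (1 + 1)).F (1 + 1) :=
    Universe.cup2C_mem_F_two_of_Uiso hH hcup2 Γ K (Ψ 2) (Ψ 3) σ (hU 2) (hU 3)
  have hper : U.period (U.pms L ι₁ V Γ) ω ≠ 0 := by
    have hΛ := hcΛ (U.cup2C _ 1 (ω 0) (ω 1)) (U.cup2C _ 1 (ω 2) (ω 3)) hx hy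
    rw [Universe.period_eq_pairing_wedges]
    intro h0
    apply hne
    rw [hΛ]
    exact mul_eq_zero_of_right c h0
  exact Universe.periodNV_of_period_ne_zero Γ ω hU hper

/-- **PKG `thm44_of_realisation₂` in tree vocabulary — the MEETING-form engine** (`Model/EndStateMeet.lean`:200–222): an isolation
setting `S`; the typing of the theta (12)-one-forms (`Theta_sub`, used for `i = 0, 1`); item (vi)'s line field (PerL Prop 4.3); C5′
`gen12Meet` and C6′ `real34Meet` in the literal shapes of the fields of `Universe.ThetaRealisation₂` (:141–150, with the wedge-function
`Λ Γ ω₁ ω₂` spelled `emb Γ (ω₁ ∪ ω₂)`); and item (iii)'s Petersson = period `inner_emb` ⇒ `U.PeriodNV ι₁ V K Ψ σ`.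
Step 1: the line field; Step 2′: `gen12Meet`, then **Thm 3.7** `S₁₂ = S₃₄` (ported `Perl34.IsolationSetting.C2_S12_eq_S34`) and
`TorusData.S12_def` + the closure-span lemma give a generator `ϑ_{T′,χ}(Φ)` (`χ` allowed) pairing non-trivially with the wedge;
Steps 3′–4′: `real34Meet`; Steps 5–6: `periodNV_of_inner_wedgeFns_ne_zero`.  No level change, hence no `Fact_pull_comp`∕`Fact_pull_cup`.
[folklore] -/
theorem periodNV_ofSetting_meet (hH : U.Fact_pull_hodge) (hcup2 : U.Fact_cup2_hodge)
    {K : CMField} {Ψ : Fin 4 → CMType K} {σ : K →+* ℂ}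
    (S : Perl34.IsolationSetting H HG CG G SK SigIdx SigIdxG)
    (Theta_sub : ∀ (i : Fin 4) (Γ : Level V), Θ i Γ ⊆ U.Uiso Γ K (Ψ i) σ)
    (lineField : ∃ (Γ : Level V), ∃ ω₁ ∈ Θ 0 Γ, ∃ ω₂ ∈ Θ 1 Γ, emb Γ (U.cup2C (U.pms L ι₁ V Γ) 1 ω₁ ω₂) ≠ 0)
    (gen12Meet : ∀ (Γ : Level V) (ω₁ ω₂ : U.CohC (U.pms L ι₁ V Γ) 1), ω₁ ∈ Θ 0 Γ → ω₂ ∈ Θ 1 Γ →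
      emb Γ (U.cup2C (U.pms L ι₁ V Γ) 1 ω₁ ω₂) ≠ 0 →
        ∃ u ∈ S.t12.S12, ⟪emb Γ (U.cup2C (U.pms L ι₁ V Γ) 1 ω₁ ω₂), u⟫_ℂ ≠ 0)
    (real34Meet : ∀ χ : S.t34.X, S.t34.allowed χ → ∀ (Φ : SK) (Γ₁ : Level V) (ω₁ ω₂ : U.CohC (U.pms L ι₁ V Γ₁) 1),
      ω₁ ∈ U.Uiso Γ₁ K (Ψ 0) σ → ω₂ ∈ U.Uiso Γ₁ K (Ψ 1) σ →
        ⟪emb Γ₁ (U.cup2C (U.pms L ι₁ V Γ₁) 1 ω₁ ω₂), S.t34.ϑ χ Φ⟫_ℂ ≠ 0 →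
          ∃ (Γ : Level V) (ω : Fin 4 → U.CohC (U.pms L ι₁ V Γ) 1), (∀ i, ω i ∈ U.Uiso Γ K (Ψ i) σ) ∧
            ⟪emb Γ (U.cup2C (U.pms L ι₁ V Γ) 1 (ω 2) (ω 3)), emb Γ (U.cup2C (U.pms L ι₁ V Γ) 1 (ω 0) (ω 1))⟫_ℂ ≠ 0)
    (inner_emb : ∀ Γ : Level V, ∃ c : ℂ, c ≠ 0 ∧ ∀ x y : U.CohC (U.pms L ι₁ V Γ) 2,
      x ∈ (U.hodge (U.pms L ι₁ V Γ) 2).F 2 → y ∈ (U.hodge (U.pms L ι₁ V Γ) 2).F 2 →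
        ⟪emb Γ y, emb Γ x⟫_ℂ = c * U.trC (U.pms L ι₁ V Γ) 4 (U.cup2C (U.pms L ι₁ V Γ) 2 x (conj y))) :
    U.PeriodNV ι₁ V K Ψ σ := by
  -- Step 1: a theta (12)-wedge with non-zero wedge-function at some level Γ₁ (Prop 4.3)
  obtain ⟨Γ₁, ω₁, hω₁, ω₂, hω₂, hv⟩ := lineField
  -- Step 2′: not orthogonal to S₁₂ = S₃₄ (Thm 3.7), hence pairs non-trivially with some generator ϑ_{T′,χ}(Φ)
  obtain ⟨u, huS, hu⟩ := gen12Meet Γ₁ ω₁ ω₂ hω₁ hω₂ hv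
  rw [S.C2_S12_eq_S34, S.t34.S12_def] at huS
  obtain ⟨w, ⟨χ, hχ, Φ, rfl⟩, hw⟩ := exists_inner_ne_zero_of_mem_closure_span hu huS
  -- Steps 3′–4′: reality-meeting at one level
  obtain ⟨Γ, ω, hU, hinner⟩ := real34Meet χ hχ Φ Γ₁ ω₁ ω₂ (Theta_sub 0 Γ₁ hω₁) (Theta_sub 1 Γ₁ hω₂) hw
  -- Steps 5–6
  exact periodNV_of_inner_wedgeFns_ne_zero hH hcup2 inner_emb Γ ω hU hinner

/-- **MONOTONICITY** (PKG `ThetaRealisation₁.toMeet₂`, `EndStateMeet.lean`:160–183, first half): the classical Lemma-3.5 membership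
`Gen12` gives the meeting form C5′ with `u :=` the wedge-function itself. [folklore] -/
theorem gen12Meet_of_gen12 (S : Perl34.IsolationSetting H HG CG G SK SigIdx SigIdxG) (hg : Gen12 U emb Θ (Datum.ofSetting S)) :
    ∀ (Γ : Level V) (ω₁ ω₂ : U.CohC (U.pms L ι₁ V Γ) 1), ω₁ ∈ Θ 0 Γ → ω₂ ∈ Θ 1 Γ →
      emb Γ (U.cup2C (U.pms L ι₁ V Γ) 1 ω₁ ω₂) ≠ 0 →
        ∃ u ∈ S.t12.S12, ⟪emb Γ (U.cup2C (U.pms L ι₁ V Γ) 1 ω₁ ω₂), u⟫_ℂ ≠ 0 :=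
  fun Γ ω₁ ω₂ h₁ h₂ hne => ⟨_, hg Γ ω₁ ω₂ h₁ h₂, inner_self_ne_zero.mpr hne⟩

end IsolationSpans

namespace IsolationSpans

variable {U : Universe} {L : CMField} {ι₁ : L →+* ℂ} {V : HermSpace3 L ι₁}
  {H HG CG G SK SigIdx SigIdxG : Type}
  [NormedAddCommGroup H] [InnerProductSpace ℂ H] [CompleteSpace H]
  [NormedAddCommGroup HG] [InnerProductSpace ℂ HG] [CompleteSpace HG]
  [NormedAddCommGroup CG] [NormedSpace ℂ CG]
  [Group G] [TopologicalSpace G] [TopologicalSpace SK]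

/-- **The socket datum from stage-1-shaped realisation data** (PKG `Universe.ThetaRealisation`, `Automorphic/Realisation.lean`:102–160,
field for field, with `S`∕`gen12`∕`real34` collapsed into `coupling` by `ofSetting`): an isolation setting over `HG = L²([G_U])` (in
`Type`, as the socket demands), `emb`, the theta one-form sets `Θ` with their typing, the line field, the two Lemma-3.5 memberships and
item (iii)'s bookkeeping ASSEMBLE to `U.FaceThetaDatum ι₁ V K Ψ σ` (`B01/ThetaRealisationSocket.lean`:66) — the structure whose
existence per field-and-face is `Universe.FaceThetaDataExists` (`Transposition/Assembly.lean`:52).  Face setting: `K = L = F`,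
`Ψ = f.psi`, `σ = ι₁`. [folklore] -/
def faceThetaDatum_ofSetting {K : CMField} {Ψ : Fin 4 → CMType K} {σ : K →+* ℂ}
    (S : Perl34.IsolationSetting H HG CG G SK SigIdx SigIdxG)
    (emb : ∀ Γ : Level V, U.CohC (U.pms L ι₁ V Γ) 2 →ₗ[ℂ] HG)
    (Θ : Fin 4 → ∀ Γ : Level V, Set (U.CohC (U.pms L ι₁ V Γ) 1))
    (Theta_sub : ∀ (i : Fin 4) (Γ : Level V), Θ i Γ ⊆ U.Uiso Γ K (Ψ i) σ)
    (lineField : ∃ (Γ : Level V), ∃ ω₁ ∈ Θ 0 Γ, ∃ ω₂ ∈ Θ 1 Γ, emb Γ (U.cup2C (U.pms L ι₁ V Γ) 1 ω₁ ω₂) ≠ 0)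
    (hg : Gen12 U emb Θ (Datum.ofSetting S))
    (hr : ∀ χ : S.t34.X, S.t34.allowed χ → ∀ Φ : SK,
      S.t34.ϑ χ Φ ∈ (Submodule.span ℂ (thetaWedgeFns U emb Θ 2 3)).topologicalClosure)
    (cover : ∀ (Γ Γ' : Level V), Γ' ≤ Γ → U.Mor (U.pms L ι₁ V Γ') (U.pms L ι₁ V Γ))
    (emb_cover : ∀ (Γ Γ' : Level V) (hle : Γ' ≤ Γ) (x : U.CohC (U.pms L ι₁ V Γ) 2),
      emb Γ' (U.pullC (cover Γ Γ' hle) 2 x) = emb Γ x)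
    (inner_emb : ∀ Γ : Level V, ∃ c : ℂ, c ≠ 0 ∧ ∀ x y : U.CohC (U.pms L ι₁ V Γ) 2,
      x ∈ (U.hodge (U.pms L ι₁ V Γ) 2).F 2 → y ∈ (U.hodge (U.pms L ι₁ V Γ) 2).F 2 →
        ⟪emb Γ y, emb Γ x⟫_ℂ = c * U.trC (U.pms L ι₁ V Γ) 4 (U.cup2C (U.pms L ι₁ V Γ) 2 x (conj y))) :
    U.FaceThetaDatum ι₁ V K Ψ σ :=
  IsolationSpans.faceThetaDatum emb Θ Theta_sub lineField (ofSetting S hg hr) cover emb_cover inner_emb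

end IsolationSpans

end Transposition

end Summit.HodgeConjecture.CorCM

end
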